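import Literature.AlgebraicGeometry.Motives.AbelianVarietyWeilPairingConjugate
import Literature.AlgebraicGeometry.Motives.AbelianVarietyWeilPairingBaseChange
import Literature.AlgebraicGeometry.Motives.AbelianVarietyWeilPairingPullback
import Literature.AlgebraicGeometry.Motives.AbelianVarietyConjugateBaseChangeAlong
import Literature.AlgebraicGeometry.Motives.AbelianVarietyWeilPairingAlgClosure
import HarnessLib

/-!
# The Weil pairing of the conjugate structure read after base change: `ē^{(X^γ)_L}((t^γ)_L, (s^γ)_L) =
# ē^{(X_L)^σ}((t_L)^σ, (s_L)^σ) = γ(ē^X(t, s))` for `σ|_k = γ` (Shimura 1998, §18.6 proof, pp. 129–131)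

Layer `Literature/AlgebraicGeometry/Motives`, namespace `Literature.AlgebraicGeometry.Motives.AbelianVariety`.
KERNEL ONLY: theorems; no definition, no instance, no named fact, no `sorry` (net Literature debt 0).
Cell `hodgecm-mathlib` (D-0151), row II-1 `shimura1998_thm18_6` v2, stub S5 `polarisationTransport` in B-p12's
DIVISOR-FREE route (bus 2026-08-28T03:45:51Z, steps (2)–(4); director g1 03:48:03Z: step (3) = this file; S5 lead
B-p20).

THE PRINT.  G. Shimura, *Abelian Varieties with Complex Multiplication and Modular Functions* (1998), proof of
Thm. 18.6, pp. 128–131: the structure `(A, 𝒞, ι)` is replaced by an `L`-rational model, `σ ∈ Aut(ℂ/K*)` restricts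
to `γ = [𝔓, L/K*]` on `L`, and «for every object `Y` rational over `L`» the conjugate `Y^σ` is computed on the model
(`A^σ`, `X^σ`, `t^σ`); p. 131: «`X^σ` corresponds to `ζ′` with respect to `ξ′`» is read through the values of
Weil pairings `e_N^{X^σ}(t^σ, s^σ) = e_N^X(t, s)^σ` at `L`-rational torsion points.  Lang, *Abelian Varieties*,
VII §2 Prop. 3 (`e_N` is defined over the field of definition, hence `e^{X^σ}(a^σ, b^σ) = e^X(a, b)^σ` for every
automorphism `σ` of the universal domain); Milne 1986 §16 (the `ē_m` are Galois equivariant).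

SETTING.  `k ⊆ L` fields (`[Algebra k L]`; in the cell `k` = Shimura's number field `L`, `L = ℂ`), `γ : k ≃+* k`,
`σ : L ≃+* L` EXTENDING `γ` (`hσ : σ (ι x) = ι (γ x)`), `A₀` an abelian variety over `k`, `X` a Cartier divisor on
`A₀`, `t, s ∈ A₀[N](k)` `k`-RATIONAL torsion points (Shimura's condition (i) «the points of `A[M]` are rational over
`L`»).  Notation: `t_L := pointsMulEquiv (t extended to L) ∈ (A₀ ⊗ L)(L)`, `t^γ := conjPoints γ t ∈ A₀^γ(k)`,
`pr : A₀ ⊗ L → A₀`, `π_σ : (A₀ ⊗ L)^σ → A₀ ⊗ L`, `π_γ : A₀^γ → A₀`, `pr′ : A₀^γ ⊗ L → A₀^γ` the projections (passed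
as variables with defining equations, as in `AbelianVarietyWeilPairingBaseChange` / `…Conjugate`).

WHAT IS PROVED (all by COMPOSING B-p20's transport theorems `weilPairingLevel_conjugate` (p599039),
`weilPairingLevel_baseChange` (p601496), `weilPairingLevel_pullback_eq` (p598346) with B-p12's
`conjugateBaseChangeAlongIso` (p602992)):
* §1 `pointsMulEquiv_extendScalars_mem_torsionPoints` — `t_L` is `N`-torsion;
* §2 **`weilPairingLevel_conjugate_pointsMulEquiv`** (carrier `(A₀ ⊗ L)^σ`):
  `ē_N^{(pr^*X)^σ}((t_L)^σ, (s_L)^σ) = σ (ι (ē_N^X(t, s)))`, and `…_eq_algebraMap`: `= ι (γ (ē_N^X(t, s)))`;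
* §3 **`weilPairingLevel_baseChange_conjugate`** (carrier `A₀^γ ⊗ L`):
  `ē_N^{pr′^*(X^γ)}((t^γ)_L, (s^γ)_L) = ι (γ (ē_N^X(t, s)))`;
* §4 **`weilPairingLevel_conjugateBaseChangeAlongIso`** (bridge): for `e : A₀^γ ⊗ L ≅ (A₀ ⊗ L)^σ`
  (`conjugateBaseChangeAlongIso γ σ hσ A₀`) and any `P, Q ∈ (A₀^γ ⊗ L)[N](L)`,
  `ē_N^{pr′^*(X^γ)}(P, Q) = ē_N^{(pr^*X)^σ}(e P, e Q)` — `e^*((pr^*X)^σ)` and `pr′^*(X^γ)` are the same divisor,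
  both being `X` pulled back along `A₀^γ ⊗ L → A₀` (`toSchemeHom_conjugateBaseChangeAlongIso_hom_comp_fst_fst`).

## References
* [Shimura1998] G. Shimura, *Abelian Varieties with Complex Multiplication and Modular Functions* (1998), §18.6 proof
  of Thm. 18.6, pp. 128–131.
* [Lang1983AbelianVarieties] S. Lang, *Abelian Varieties*, Ch. VII §2, Props. 2–3.
* [Milne1986AbelianVarieties] J. S. Milne, *Abelian varieties*, in Cornell–Silverman (1986), §16.
-/

universe u

open CategoryTheory CategoryTheory.Limits AlgebraicGeometry

noncomputable section

namespace Literature.AlgebraicGeometry.Motives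

namespace AbelianVariety

/-! ## §1 Base change of rational torsion points -/

section Torsion

variable {k : Type u} [Field k] (L : Type u) [Field L] [Algebra k L] (A₀ : AbelianVariety k) {N : ℕ}

/-- `t_L := pointsMulEquiv (t ⊗ L)` is `N`-torsion for `t ∈ A₀[N](k)` (extension of scalars and `A(L) ≃ A_L(L)` are
group homomorphisms). [cite: MumfordAV1970, §4] -/
theorem pointsMulEquiv_extendScalars_mem_torsionPoints {t : A₀.Points k} (ht : t ∈ A₀.torsionPoints k N) :
    A₀.pointsMulEquiv L (AlgPoints.extendScalars A₀.X k L t) ∈ (A₀.baseChange L).torsionPoints L N := by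
  rw [mem_torsionPoints_iff] at ht ⊢
  rw [← AlgPoints.extendScalarsMonoidHom_apply, ← map_zpow, ← map_zpow, ht, map_one, map_one]

/-- `t_L` lies over `t`: `(t_L) ≫ pr = (Spec L → Spec k) ≫ t`. [cite: GortzWedhorn2020, Section (4.7) (points of a base change)] -/
theorem pointsMulEquiv_extendScalars_left_comp_fst (t : A₀.Points k) :
    (A₀.pointsMulEquiv L (AlgPoints.extendScalars A₀.X k L t)).left ≫ pullback.fst A₀.X.hom (bcSpec k L) =
      bcSpec k L ≫ t.left :=
  A₀.pointsMulEquiv_left_comp_eq L _ t rfl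

end Torsion

/-! ## §2 Carrier `(A₀ ⊗ L)^σ`: `ē^{(pr^*X)^σ}((t_L)^σ, (s_L)^σ) = σ(ι(ē^X(t, s))) = ι(γ(ē^X(t, s)))` -/

section ConjugateOfBaseChange

variable {k : Type u} [Field k] (L : Type u) [Field L] [Algebra k L] (γ : k ≃+* k) (σ : L ≃+* L)
  (A₀ : AbelianVariety k)
  (pr : (A₀.baseChange L).X.left ⟶ A₀.X.left) (hpr : pr = pullback.fst A₀.X.hom (bcSpec k L)) [IsDominant pr]
  (πσ : ((A₀.baseChange L).conjugate σ).X.left ⟶ (A₀.baseChange L).X.left)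
  (hπσ : πσ = baseChangeHomFst σ.toRingHom (A₀.baseChange L).X) [IsDominant πσ]
  {N : ℕ} [IsDominant (Hom.toSchemeHom ((N : ℤ) • 𝟙 A₀))]
  [IsDominant (Hom.toSchemeHom ((N : ℤ) • 𝟙 (A₀.baseChange L)))]
  [IsDominant (Hom.toSchemeHom ((N : ℤ) • 𝟙 ((A₀.baseChange L).conjugate σ)))]

include hpr hπσ in
/-- **The Weil pairing of the `σ`-conjugate of `A₀ ⊗ L` at the conjugates of `k`-rational torsion points**:
`ē_N^{(pr^*X)^σ}((t_L)^σ, (s_L)^σ) = σ (ι (ē_N^X(t, s)))` — Lang VII §2 Prop. 3 twice: base change `k → L`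
(`weilPairingLevel_baseChange`) and conjugation by `σ` (`weilPairingLevel_conjugate`).
[cite: Lang1983AbelianVarieties, Ch. VII §2 Prop. 3] [cite: Shimura1998, §18.6 proof of Thm. 18.6, pp. 129–131] -/
theorem weilPairingLevel_conjugate_pointsMulEquiv (X : CartierDivisor A₀.X.left) (t s : A₀.torsionPoints k N) :
    ((A₀.baseChange L).conjugate σ).weilPairingLevel ((X.pullback pr).pullback πσ)
        ⟨(A₀.baseChange L).conjPoints σ (A₀.pointsMulEquiv L (AlgPoints.extendScalars A₀.X k L t.1)),
          (A₀.baseChange L).conjPoints_mem_torsionPoints σ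
            (A₀.pointsMulEquiv_extendScalars_mem_torsionPoints L t.2)⟩
        ⟨(A₀.baseChange L).conjPoints σ (A₀.pointsMulEquiv L (AlgPoints.extendScalars A₀.X k L s.1)),
          (A₀.baseChange L).conjPoints_mem_torsionPoints σ
            (A₀.pointsMulEquiv_extendScalars_mem_torsionPoints L s.2)⟩ =
      σ (algebraMap k L (A₀.weilPairingLevel X t s)) := by
  have hP : (A₀.pointsMulEquiv L (AlgPoints.extendScalars A₀.X k L t.1)).left ≫ pr = bcSpec k L ≫ t.1.left := by
    rw [hpr]; exact A₀.pointsMulEquiv_extendScalars_left_comp_fst L t.1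
  have hQ : (A₀.pointsMulEquiv L (AlgPoints.extendScalars A₀.X k L s.1)).left ≫ pr = bcSpec k L ≫ s.1.left := by
    rw [hpr]; exact A₀.pointsMulEquiv_extendScalars_left_comp_fst L s.1
  refine ((A₀.baseChange L).weilPairingLevel_conjugate σ πσ hπσ (X.pullback pr)
      ⟨A₀.pointsMulEquiv L (AlgPoints.extendScalars A₀.X k L t.1),
        A₀.pointsMulEquiv_extendScalars_mem_torsionPoints L t.2⟩
      ⟨A₀.pointsMulEquiv L (AlgPoints.extendScalars A₀.X k L s.1),
        A₀.pointsMulEquiv_extendScalars_mem_torsionPoints L s.2⟩).trans ?_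
  exact congrArg σ (A₀.weilPairingLevel_baseChange L pr hpr X t s
      ⟨A₀.pointsMulEquiv L (AlgPoints.extendScalars A₀.X k L t.1),
        A₀.pointsMulEquiv_extendScalars_mem_torsionPoints L t.2⟩
      ⟨A₀.pointsMulEquiv L (AlgPoints.extendScalars A₀.X k L s.1),
        A₀.pointsMulEquiv_extendScalars_mem_torsionPoints L s.2⟩ hP hQ)

variable (hσ : ∀ x, σ (algebraMap k L x) = algebraMap k L (γ x))

include hpr hπσ hσ in
/-- **… `= ι (γ (ē_N^X(t, s)))` when `σ` extends `γ`** (`σ ∘ ι = ι ∘ γ`): Shimura's «`Y^σ` for `Y` rational over `L`,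
`σ = [𝔓, L/K*]` on `L`» — the value of the pairing of the conjugate structure is `γ` of an element of `k`.
[cite: Shimura1998, §18.6 proof of Thm. 18.6, pp. 128–131] [cite: Lang1983AbelianVarieties, Ch. VII §2 Prop. 3] -/
theorem weilPairingLevel_conjugate_pointsMulEquiv_eq_algebraMap (X : CartierDivisor A₀.X.left)
    (t s : A₀.torsionPoints k N) :
    ((A₀.baseChange L).conjugate σ).weilPairingLevel ((X.pullback pr).pullback πσ)
        ⟨(A₀.baseChange L).conjPoints σ (A₀.pointsMulEquiv L (AlgPoints.extendScalars A₀.X k L t.1)),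
          (A₀.baseChange L).conjPoints_mem_torsionPoints σ
            (A₀.pointsMulEquiv_extendScalars_mem_torsionPoints L t.2)⟩
        ⟨(A₀.baseChange L).conjPoints σ (A₀.pointsMulEquiv L (AlgPoints.extendScalars A₀.X k L s.1)),
          (A₀.baseChange L).conjPoints_mem_torsionPoints σ
            (A₀.pointsMulEquiv_extendScalars_mem_torsionPoints L s.2)⟩ =
      algebraMap k L (γ (A₀.weilPairingLevel X t s)) := by
  rw [A₀.weilPairingLevel_conjugate_pointsMulEquiv L σ pr hpr πσ hπσ X t s, hσ]

end ConjugateOfBaseChange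

/-! ## §3 Carrier `A₀^γ ⊗ L`: `ē^{pr′^*(X^γ)}((t^γ)_L, (s^γ)_L) = ι(γ(ē^X(t, s)))` -/

section BaseChangeOfConjugate

variable {k : Type u} [Field k] (L : Type u) [Field L] [Algebra k L] (γ : k ≃+* k) (A₀ : AbelianVariety k)
  (πγ : (A₀.conjugate γ).X.left ⟶ A₀.X.left) (hπγ : πγ = baseChangeHomFst γ.toRingHom A₀.X) [IsDominant πγ]
  (pr' : ((A₀.conjugate γ).baseChange L).X.left ⟶ (A₀.conjugate γ).X.left)
  (hpr' : pr' = pullback.fst (A₀.conjugate γ).X.hom (bcSpec k L)) [IsDominant pr']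
  {N : ℕ} [IsDominant (Hom.toSchemeHom ((N : ℤ) • 𝟙 A₀))]
  [IsDominant (Hom.toSchemeHom ((N : ℤ) • 𝟙 (A₀.conjugate γ)))]
  [IsDominant (Hom.toSchemeHom ((N : ℤ) • 𝟙 ((A₀.conjugate γ).baseChange L)))]

include hπγ hpr' in
/-- **The Weil pairing of the conjugate `A₀^γ` read after base change to `L`** at the base changes of the conjugate
torsion points: `ē_N^{pr′^*(X^γ)}((t^γ)_L, (s^γ)_L) = ι (γ (ē_N^X(t, s)))` — conjugation by `γ` over `k`
(`weilPairingLevel_conjugate`: `ē^{X^γ}(t^γ, s^γ) = γ ē^X(t, s)`) followed by extension of scalars `k → L`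
(`weilPairingLevel_baseChange`).  Shimura: `e^{X^σ}(t^σ, s^σ) = e^X(t, s)^σ` computed on the `L`-model.
[cite: Shimura1998, §18.6 proof of Thm. 18.6, pp. 128–131] [cite: Lang1983AbelianVarieties, Ch. VII §2 Prop. 3] -/
theorem weilPairingLevel_baseChange_conjugate (X : CartierDivisor A₀.X.left) (t s : A₀.torsionPoints k N) :
    ((A₀.conjugate γ).baseChange L).weilPairingLevel ((X.pullback πγ).pullback pr')
        ⟨(A₀.conjugate γ).pointsMulEquiv L (AlgPoints.extendScalars (A₀.conjugate γ).X k L (A₀.conjPoints γ t.1)),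
          (A₀.conjugate γ).pointsMulEquiv_extendScalars_mem_torsionPoints L (A₀.conjPoints_mem_torsionPoints γ t.2)⟩
        ⟨(A₀.conjugate γ).pointsMulEquiv L (AlgPoints.extendScalars (A₀.conjugate γ).X k L (A₀.conjPoints γ s.1)),
          (A₀.conjugate γ).pointsMulEquiv_extendScalars_mem_torsionPoints L
            (A₀.conjPoints_mem_torsionPoints γ s.2)⟩ =
      algebraMap k L (γ (A₀.weilPairingLevel X t s)) := by
  have hP : ((A₀.conjugate γ).pointsMulEquiv L
      (AlgPoints.extendScalars (A₀.conjugate γ).X k L (A₀.conjPoints γ t.1))).left ≫ pr' =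
        bcSpec k L ≫ (A₀.conjPoints γ t.1).left := by
    rw [hpr']; exact (A₀.conjugate γ).pointsMulEquiv_extendScalars_left_comp_fst L _
  have hQ : ((A₀.conjugate γ).pointsMulEquiv L
      (AlgPoints.extendScalars (A₀.conjugate γ).X k L (A₀.conjPoints γ s.1))).left ≫ pr' =
        bcSpec k L ≫ (A₀.conjPoints γ s.1).left := by
    rw [hpr']; exact (A₀.conjugate γ).pointsMulEquiv_extendScalars_left_comp_fst L _
  refine ((A₀.conjugate γ).weilPairingLevel_baseChange L pr' hpr' (X.pullback πγ)
      ⟨A₀.conjPoints γ t.1, A₀.conjPoints_mem_torsionPoints γ t.2⟩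
      ⟨A₀.conjPoints γ s.1, A₀.conjPoints_mem_torsionPoints γ s.2⟩
      ⟨(A₀.conjugate γ).pointsMulEquiv L (AlgPoints.extendScalars (A₀.conjugate γ).X k L (A₀.conjPoints γ t.1)),
        (A₀.conjugate γ).pointsMulEquiv_extendScalars_mem_torsionPoints L (A₀.conjPoints_mem_torsionPoints γ t.2)⟩
      ⟨(A₀.conjugate γ).pointsMulEquiv L (AlgPoints.extendScalars (A₀.conjugate γ).X k L (A₀.conjPoints γ s.1)),
        (A₀.conjugate γ).pointsMulEquiv_extendScalars_mem_torsionPoints L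
          (A₀.conjPoints_mem_torsionPoints γ s.2)⟩ hP hQ).trans ?_
  exact congrArg (algebraMap k L) (A₀.weilPairingLevel_conjugate γ πγ hπγ X t s)

end BaseChangeOfConjugate

/-! ## §4 The bridge along `e : A₀^γ ⊗ L ≅ (A₀ ⊗ L)^σ` -/

section Bridge

variable {k : Type u} [Field k] (L : Type u) [Field L] [Algebra k L] (γ : k ≃+* k) (σ : L ≃+* L)
  (hσ : ∀ x, σ (algebraMap k L x) = algebraMap k L (γ x)) (A₀ : AbelianVariety k)
  (pr : (A₀.baseChange L).X.left ⟶ A₀.X.left) (hpr : pr = pullback.fst A₀.X.hom (bcSpec k L)) [IsDominant pr]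
  (πσ : ((A₀.baseChange L).conjugate σ).X.left ⟶ (A₀.baseChange L).X.left)
  (hπσ : πσ = baseChangeHomFst σ.toRingHom (A₀.baseChange L).X) [IsDominant πσ]
  (πγ : (A₀.conjugate γ).X.left ⟶ A₀.X.left) (hπγ : πγ = baseChangeHomFst γ.toRingHom A₀.X) [IsDominant πγ]
  (pr' : ((A₀.conjugate γ).baseChange L).X.left ⟶ (A₀.conjugate γ).X.left)
  (hpr' : pr' = pullback.fst (A₀.conjugate γ).X.hom (bcSpec k L)) [IsDominant pr']
  {N : ℕ} [IsDominant (Hom.toSchemeHom ((N : ℤ) • 𝟙 ((A₀.baseChange L).conjugate σ)))]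
  [IsDominant (Hom.toSchemeHom ((N : ℤ) • 𝟙 ((A₀.conjugate γ).baseChange L)))]

include hpr hπσ hπγ hpr' in
/-- **`e^*((pr^*X)^σ)` and `pr′^*(X^γ)` are the same divisor on `A₀^γ ⊗ L`** for
`e = conjugateBaseChangeAlongIso γ σ hσ A₀`: both are the pullback of `X` along `A₀^γ ⊗ L → A₀`
(`e ≫ π_σ ≫ pr = pr′ ≫ π_γ`, `toSchemeHom_conjugateBaseChangeAlongIso_hom_comp_fst_fst`).
[cite: Shimura1998, §18.6 proof of Thm. 18.6, pp. 128–130] [cite: GortzWedhorn2020, Prop. 4.16 and §(4.7)] -/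
theorem pullback_conjugateBaseChangeAlongIso_sameDivisor (X : CartierDivisor A₀.X.left) :
    haveI : IsDominant (Hom.toSchemeHom (conjugateBaseChangeAlongIso γ σ hσ A₀).hom) :=
      isDominant_toSchemeHom_iso_hom (conjugateBaseChangeAlongIso γ σ hσ A₀)
    ((X.pullback πγ).pullback pr').SameDivisor
      (((X.pullback pr).pullback πσ).pullback (Hom.toSchemeHom (conjugateBaseChangeAlongIso γ σ hσ A₀).hom)) := by
  haveI := isDominant_toSchemeHom_iso_hom (conjugateBaseChangeAlongIso γ σ hσ A₀)
  have hcomp : Hom.toSchemeHom (conjugateBaseChangeAlongIso γ σ hσ A₀).hom ≫ πσ ≫ pr = pr' ≫ πγ := by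
    rw [hpr, hπσ, hpr', hπγ]
    exact toSchemeHom_conjugateBaseChangeAlongIso_hom_comp_fst_fst γ σ hσ A₀
  haveI : IsDominant (pr' ≫ πγ) := inferInstance
  haveI : IsDominant (πσ ≫ pr) := inferInstance
  haveI : IsDominant (Hom.toSchemeHom (conjugateBaseChangeAlongIso γ σ hσ A₀).hom ≫ πσ ≫ pr) := inferInstance
  exact ((X.pullback_pullback_sameDivisor πγ pr').trans (X.pullback_congr_sameDivisor hcomp.symm)).trans
    (((X.pullback_pullback_sameDivisor pr πσ).pullback _).trans
      (CartierDivisor.pullback_pullback_sameDivisor X (πσ ≫ pr) _)).symm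

include hpr hπσ hπγ hpr' in
/-- **The bridge: `ē_N^{pr′^*(X^γ)}(P, Q) = ē_N^{(pr^*X)^σ}(e P, e Q)`** for `e = conjugateBaseChangeAlongIso γ σ hσ A₀`
and any `P, Q ∈ (A₀^γ ⊗ L)[N](L)` — the Weil pairing is transported along the isomorphism `e`
(`weilPairingLevel_eq_of_sameDivisor_pullback` with `e^*((pr^*X)^σ) ∼ pr′^*(X^γ)`); with B-p12's points formula
`e((t^γ)_L) = (t_L)^σ` (`map_conjugateBaseChangeAlongIso_hom_pointsMulEquiv_extendScalars_conjPoints`) this identifies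
§3 with §2. [cite: Shimura1998, §18.6 proof of Thm. 18.6, pp. 128–131] [cite: MumfordAV1970, §20 (3) (p. 186)] -/
theorem weilPairingLevel_conjugateBaseChangeAlongIso (X : CartierDivisor A₀.X.left)
    (P Q : ((A₀.conjugate γ).baseChange L).torsionPoints L N) :
    ((A₀.conjugate γ).baseChange L).weilPairingLevel ((X.pullback πγ).pullback pr') P Q =
      ((A₀.baseChange L).conjugate σ).weilPairingLevel ((X.pullback pr).pullback πσ)
        ⟨AlgPoints.map (conjugateBaseChangeAlongIso γ σ hσ A₀).hom.hom.hom.hom P.1,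
          map_mem_torsionPoints (conjugateBaseChangeAlongIso γ σ hσ A₀).hom P.2⟩
        ⟨AlgPoints.map (conjugateBaseChangeAlongIso γ σ hσ A₀).hom.hom.hom.hom Q.1,
          map_mem_torsionPoints (conjugateBaseChangeAlongIso γ σ hσ A₀).hom Q.2⟩ := by
  haveI := isDominant_toSchemeHom_iso_hom (conjugateBaseChangeAlongIso γ σ hσ A₀)
  exact weilPairingLevel_eq_of_sameDivisor_pullback (conjugateBaseChangeAlongIso γ σ hσ A₀).hom _
    (A₀.pullback_conjugateBaseChangeAlongIso_sameDivisor L γ σ hσ pr hpr πσ hπσ πγ hπγ pr' hpr' X) P Q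

end Bridge

end AbelianVariety

end Literature.AlgebraicGeometry.Motives

end
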